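import Summits.BirchSwinnertonDyer.BirchSwinnertonDyer.Theses.FrozenTwin
import Summits.BirchSwinnertonDyer.BirchSwinnertonDyer.Theses.ToricShedding
import Summits.BirchSwinnertonDyer.BirchSwinnertonDyer.Theses.PAdicOrderV2
import Literature.NumberTheory.EllipticCurves.KatoRankBound
import Literature.NumberTheory.EllipticCurves.CuspFormLFunction
import Literature.NumberTheory.EllipticCurves.BSDSelmerParityDokchitserProofs
import HarnessLib

/-!
# Line `birth` — birth skeleton for crux `UBPotentiallyGood` (stmt-BirchSwinnertonDyer-15878)

Crux (route FrozenTwin #4; byte-identical decl in route ToricShedding #5, the item's primary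
route): **the potentially-good sector of the Selmer-rank upper bound at ONE big-image good
ordinary prime**,
`∀ W elliptic, globally minimal, (¬ ∃ q, multiplicative reduction at q) → ∀ p prime, 5 ≤ p →
good at p → p ∤ a_p → ρ̄_{E,p} surjective → corank_{ℤ_p} Sel_{p^∞}(E/ℚ) ≤ ord_{s=1} L(E,s)`.

## The cut (planner skeleton registrar, 2026-08-17): the cyclotomic line

Both anticyclotomic routes that want this crux (ToricShedding: bipartite Euler system on a
definite Shimura set; FrozenTwin: class-group twin read off Gross points) need an odd number of
inert primes of MULTIPLICATIVE reduction, and Skinner–Urban's main conjecture needs a prime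
`q ‖ N` — none exists in this sector. The one Euler system that asks for no Steinberg prime is
Kato's: at every good ordinary `p` it bounds the Selmer corank by the order of vanishing of the
cyclotomic `p`-adic `L`-function, unconditionally and image-free (Astérisque 295, Thm 18.4). The
skeleton therefore cuts the crux along the `(r_an ≤ 1 | r_an ≥ 2)` fault line and, on the open
side, through the `p`-adic `L`-function:

* stub **GZK** `stub_gzkRange` (LITERATURE DEBT): `r_an ≤ 1 → corank_p = r_an` at every prime —
  Gross–Zagier–Kolyvagin (`rank = r_an ∧ Ш finite`, tree fact
  `Literature.NumberTheory.EllipticCurves.rank_eq_analyticRank_of_analyticRank_le_one`, bsd.S17,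
  no `_holds`) with the PROVED corank identity; in tree the one-liner
  `selmerCorank_eq_analyticRank_of_analyticRank_le_one hGZK` (`stub_gzkRange_of_fact` below).
  It owns the regime `r_an = 1`, where the cyclotomic comparison would be the OPEN
  non-degeneracy of the `p`-adic height of the Heegner point (Perrin-Riou's `p`-adic Gross–Zagier).
* stub **MOD** `stub_modularity` (LITERATURE DEBT): every `E/ℚ` has a newform of level `N_E`
  (Wiles, Taylor–Wiles, BCDT 2001 Thm A; verbatim the body of the tree fact
  `Literature.NumberTheory.EllipticCurves.ModularForms.exists_isNewformOf`,
  `stub_modularity_of_fact`) — needed to NAME `L_p(E,T) = padicLFunction f (unitRoot W p)`.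
* stub **KATO** `stub_katoCorankBound` (LITERATURE DEBT): for `p ≥ 5` good ordinary and `f` the
  newform of `E`, `corank_{ℤ_p} Sel_{p^∞}(E/ℚ) ≤ ord_{T=0} L_p(E,T)` in `ℕ∞` — Kato 2004 Thm 18.4,
  non-exceptional clause (tree fact `kato_selmerCorank_le_order_padicLFunction W p`, restricted
  to `p ≥ 5` through `isOrdinaryAt_iff`; `stub_katoCorankBound_of_fact`).
* stub **ORD** `stub_padicOrderLeAnalyticRank` (OPEN, load-bearing): in the crux's sector and
  image/ordinarity hypotheses, and in the regime `2 ≤ r_an`: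
  `ord_{T=0} L_p(E,T) ≤ ord_{s=1} L(E,s)` — the inequality half of the Mazur–Tate–Teitelbaum
  rank conjecture BSD(p)(i) ("`p`-adic order ≤ archimedean order"). It is implied by (is the
  `≤`-half of, restricted to this sector) crux `PAdicOrderComparisonR2` of route PAdicOrderV2
  (stmt-BirchSwinnertonDyer-0489): `stub_padicOrderLeAnalyticRank_of_comparison` below, so the
  two cruxes are now linked in the kernel: 0489 ⟹ 15878 modulo GZK + modularity + Kato.

`UBPotentiallyGood_of (hGZK : Statement.stub_gzkRange) … : FrozenTwin.UBPotentiallyGood`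
(sorry-free; stub statements BY NAME via `type_of%` abbrevs): if `r_an ≤ 1` use GZK; else MOD
gives the newform `f` (instance `NeZero N_E` from the proved `conductorNorm_pos_holds`), KATO gives
`corank ≤ ord_T L_p` and ORD gives `ord_T L_p ≤ r_an` in `ℕ∞`; cast back to `ℕ`.
`UBPotentiallyGood_proof` plugs the sorried stubs in; `UBPotentiallyGood_ofToricShedding` /
`UBPotentiallyGood_proofToricShedding` conclude the byte-identical decl of the item's primary
route ToricShedding (same lambda, up to delta). No stub is the crux or the summit reworded: GZK,
MOD, KATO are theorems in print (three different decades, three different tool-kits), ORD is a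
statement about the `p`-adic `L`-function alone (no Selmer group in it) and is STRONGER than what
the crux needs in its regime exactly by Kato's slack `ord_T L_p − corank` (semisimplicity + Ш
defect) — the honest price of the cyclotomic line, recorded here rather than hidden.

Disproof used: none on file (`ledger crux ls stmt-BirchSwinnertonDyer-15878`: no workfiles,
2026-08-17). Negatives index (`ledger negatives --problem BirchSwinnertonDyer`, 2026-08-17): one
entry, `LeadingTermTamePinch_refuted` (a prime-SUPPLY statement `∀ W, ∃ p ≥ 5 ordinary ∧ …`);
no stub here asserts the existence of a prime — all are `∀ p` under hypotheses — so none is an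
instance of it.

BC3 probes (planner folder `bc/`, farm lean check 2026-08-17): for each of the four stubs,
`Stub → UBPotentiallyGood` and `Stub → BirchSwinnertonDyer` by
`first | exact? | simpa [Stub] | (unfold Stub; simpa) | aesop` FAIL, and `Stub` itself by
`first | exact? | simp | aesop` FAILS (see `Lines/birth.md` for the tally).
-/

set_option linter.dupNamespace false

namespace Summit.BirchSwinnertonDyer.BirchSwinnertonDyer.Cruxes.UBPotentiallyGood.Birth

open Summit.BirchSwinnertonDyer.BirchSwinnertonDyer.Theses.FrozenTwin (UBPotentiallyGood)

/-! ### Registered stubs -/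

/-- Stub **GZK** (literature debt, image-free, every prime): if `ord_{s=1} L(E,s) ≤ 1` then
`corank_{ℤ_p} Sel_{p^∞}(E/ℚ) = ord_{s=1} L(E,s)` — Gross–Zagier–Kolyvagin (`rank = r_an` and
`Ш(E/ℚ)` finite) with the proved corank identity `corank Sel_{p^∞} = rank + corank Ш[p^∞]`.
In tree modulo the named fact `rank_eq_analyticRank_of_analyticRank_le_one`
(`stub_gzkRange_of_fact`). Shared verbatim with the birth skeleton of crux
`SelmerRankSmallImage` (stmt-BirchSwinnertonDyer-14418). [cite: Darmon2004, Thm. 3.22] -/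
theorem stub_gzkRange :
    ∀ (W : WeierstrassCurve ℚ) [W.IsElliptic] (p : ℕ) [Fact p.Prime],
      W.analyticRank ≤ 1 → W.selmerCorank p = W.analyticRank := by
  sorry

/-- Stub **MOD** (literature debt): the Modularity Theorem with level = conductor — for every
elliptic `E/ℚ` there is a newform `f ∈ S₂(Γ₀(N_E))` with `aₙ(f) = aₙ(E)` for all `n`
(Wiles 1995; Taylor–Wiles 1995; Breuil–Conrad–Diamond–Taylor 2001 Thm A; Carayol for the level;
Diamond–Shurman Thm 8.8.3). Verbatim the body of the tree fact `exists_isNewformOf`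
(`stub_modularity_of_fact`). [cite: BreuilConradDiamondTaylor2001, Thm. A] -/
theorem stub_modularity :
    ∀ (W : WeierstrassCurve ℚ) [W.IsElliptic] [NeZero (W.conductorNorm ℤ)],
      ∃ f : CuspForm (CongruenceSubgroup.Gamma0 (W.conductorNorm ℤ)) 2,
        Literature.NumberTheory.EllipticCurves.ModularForms.IsNewformOf W f := by
  sorry

/-- Stub **KATO** (literature debt): Kato's Selmer-corank bound at a good ordinary prime
`p ≥ 5` — for `E/ℚ` (globally minimal `W`), `f` the newform of `E`, `α = unitRoot W p` and
`L_p(E,T) = padicLFunction f α ∈ ℚ_p⟦T⟧`: `corank_{ℤ_p} Sel_{p^∞}(E/ℚ) ≤ ord_{T=0} L_p(E,T)`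
(in `ℕ∞`). Kato, Astérisque 295 (2004), Thm 18.4, case `k = 2`, `K = ℚ`, non-exceptional clause
(`α ≠ 1`); the tree fact `kato_selmerCorank_le_order_padicLFunction W p` restricted to `p ≥ 5`
(`stub_katoCorankBound_of_fact`). Needs NO auxiliary multiplicative prime and NO image
hypothesis — the reason the cyclotomic line survives in the potentially-good sector.
[cite: Kato2004, Thm 18.4] -/
theorem stub_katoCorankBound :
    ∀ (W : WeierstrassCurve ℚ) [W.IsElliptic] [W.IsGloballyMinimal] (p : ℕ) [Fact p.Prime],
      5 ≤ p → W.HasGoodReductionAtPrime p → ¬ (p : ℤ) ∣ W.frobeniusTrace p →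
        ∀ {N : ℕ} [NeZero N] (f : CuspForm (CongruenceSubgroup.Gamma0 N) 2),
          Literature.NumberTheory.EllipticCurves.ModularForms.IsNewformOf W f →
            (W.selmerCorank p : ℕ∞) ≤
              (Literature.NumberTheory.EllipticCurves.padicLFunction f
                (Literature.NumberTheory.EllipticCurves.unitRoot W p : ℚ_[p])).order := by
  sorry

/-- Stub **ORD** (OPEN — the load-bearing stub): `p`-ADIC ORDER ≤ ARCHIMEDEAN ORDER in the
crux's sector and regime. For `E/ℚ` (globally minimal `W`) with NO prime of multiplicative
reduction, a prime `p ≥ 5` of good ordinary reduction with `ρ̄_{E,p}` surjective, and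
`ord_{s=1} L(E,s) ≥ 2`: for `f` the newform of `E` and `α = unitRoot W p`,
`ord_{T=0} L_p(E,T) ≤ ord_{s=1} L(E,s)` (in `ℕ∞`). This is the inequality half of clause (i) of
the Mazur–Tate–Teitelbaum `p`-adic BSD conjecture (Invent. Math. 84 (1986) §II.10; Delbourgo 2008
p. 42 Conj. 2.3(i)), restricted to this sector; conjecturally an equality. Known: `r_an = 0`
(interpolation, `L_p(0) = (1 − α⁻¹)² L(E,1)/Ω⁺`); parity `ord_T L_p ≡ r_an (mod 2)` (functional
equation of `L_p`); NOTHING at `r_an ≥ 2` (no `p`-adic Gross–Zagier formula beyond first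
derivatives; the `r_an = 1` case, excluded here, is the open non-degeneracy of the `p`-adic
height). Implied by crux `PAdicOrderComparisonR2` of route PAdicOrderV2
(`stub_padicOrderLeAnalyticRank_of_comparison`). Why it might fail: at one `(E,p)` with a
degenerate cyclotomic `p`-adic height pairing (a Jordan block of `T` of size `≥ 2` on
`X(E/ℚ_∞) ⊗ ℚ_p`), Kato's divisibility `char X ∣ L_p` and Schneider/Perrin-Riou give
`ord_T L_p ≥ ord_T char X > corank_p`, so ORD can fail at a pair where the crux
(`corank_p ≤ r_an`) still holds — the slack of the cyclotomic line; an infinitely divisible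
`Ш[p^∞]` would refute ORD and the crux together (granting BSD-rank).
[cite: MazurTateTeitelbaum1986Invent, §II.10] -/
theorem stub_padicOrderLeAnalyticRank :
    ∀ (W : WeierstrassCurve ℚ) [W.IsElliptic] [W.IsGloballyMinimal],
      (¬ ∃ (q : ℕ) (_ : Fact q.Prime), W.HasMultiplicativeReductionAtPrime q) →
        ∀ (p : ℕ) [Fact p.Prime], 5 ≤ p → W.HasGoodReductionAtPrime p →
          ¬ (p : ℤ) ∣ W.frobeniusTrace p → W.HasSurjectiveModNGaloisRep p →
            2 ≤ W.analyticRank →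
              ∀ {N : ℕ} [NeZero N] (f : CuspForm (CongruenceSubgroup.Gamma0 N) 2),
                Literature.NumberTheory.EllipticCurves.ModularForms.IsNewformOf W f →
                  (Literature.NumberTheory.EllipticCurves.padicLFunction f
                    (Literature.NumberTheory.EllipticCurves.unitRoot W p : ℚ_[p])).order ≤
                    (W.analyticRank : ℕ∞) := by
  sorry

/-! ### Stub statements by name

The skeleton gate (`#h21_check_skeleton`) reads the composition's hypotheses BY NAME: each must be
a declared stub. The `abbrev`s below are the stubs' exact elaborated types (`type_of%`), so
`UBPotentiallyGood_of` takes `(h : Statement.stub_<name>)` and nothing else. -/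

namespace Statement

/-- Statement of `stub_gzkRange`. -/
abbrev stub_gzkRange : Prop := type_of% @Birth.stub_gzkRange
/-- Statement of `stub_modularity`. -/
abbrev stub_modularity : Prop := type_of% @Birth.stub_modularity
/-- Statement of `stub_katoCorankBound`. -/
abbrev stub_katoCorankBound : Prop := type_of% @Birth.stub_katoCorankBound
/-- Statement of `stub_padicOrderLeAnalyticRank`. -/
abbrev stub_padicOrderLeAnalyticRank : Prop := type_of% @Birth.stub_padicOrderLeAnalyticRank

end Statement

/-! ### The crux from the stubs (kernel-checked composition, no `sorry`) -/

/-- **The crux BY NAME from the four stub statements** (GZK → MOD → KATO → ORD →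
`FrozenTwin.UBPotentiallyGood`, the payload route's decl): if `r_an ≤ 1` use GZK; otherwise MOD
supplies the newform `f` of `E` (level `N_E ≠ 0` by the proved `conductorNorm_pos_holds`), KATO
gives `corank_p ≤ ord_T L_p(E,T)` and ORD gives `ord_T L_p(E,T) ≤ r_an` in `ℕ∞`. [folklore] -/
theorem UBPotentiallyGood_of (hGZK : Statement.stub_gzkRange) (hMod : Statement.stub_modularity)
    (hKato : Statement.stub_katoCorankBound) (hOrd : Statement.stub_padicOrderLeAnalyticRank) :
    UBPotentiallyGood := by
  intro W _ _ hpg p _ h5 hgood hord hsurj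
  by_cases h1 : W.analyticRank ≤ 1
  · exact (hGZK W p h1).le
  · have h2 : 2 ≤ W.analyticRank := by omega
    haveI : NeZero (W.conductorNorm ℤ) := ⟨(W.conductorNorm_pos_holds).ne'⟩
    obtain ⟨f, hf⟩ := hMod W
    have hK := hKato W p h5 hgood hord f hf
    have hO := hOrd W hpg p h5 hgood hord hsurj h2 f hf
    exact_mod_cast hK.trans hO

/-- The crux along this line (route `FrozenTwin` decl, by name), MODULO exactly the four
registered stubs (depends on `sorryAx` only through `stub_*`). [folklore] -/
theorem UBPotentiallyGood_proof : UBPotentiallyGood :=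
  UBPotentiallyGood_of stub_gzkRange stub_modularity stub_katoCorankBound
    stub_padicOrderLeAnalyticRank

/-- The same composition under the byte-identical decl of route `ToricShedding` (the item's
primary route; the two `def`s have the same body, so this is `UBPotentiallyGood_of` up to delta),
sorry-free with the stub statements as named hypotheses. [folklore] -/
theorem UBPotentiallyGood_ofToricShedding (hGZK : Statement.stub_gzkRange)
    (hMod : Statement.stub_modularity) (hKato : Statement.stub_katoCorankBound)
    (hOrd : Statement.stub_padicOrderLeAnalyticRank) :
    Summit.BirchSwinnertonDyer.BirchSwinnertonDyer.Theses.ToricShedding.UBPotentiallyGood :=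
  fun W _ _ hpg p _ h5 hgood hord hsurj =>
    UBPotentiallyGood_of hGZK hMod hKato hOrd W hpg p h5 hgood hord hsurj

/-- The crux along this line under the `ToricShedding` decl, MODULO the four registered stubs.
[folklore] -/
theorem UBPotentiallyGood_proofToricShedding :
    Summit.BirchSwinnertonDyer.BirchSwinnertonDyer.Theses.ToricShedding.UBPotentiallyGood :=
  UBPotentiallyGood_ofToricShedding stub_gzkRange stub_modularity stub_katoCorankBound
    stub_padicOrderLeAnalyticRank

/-! ### What discharges each stub (kernel-checked pointers, no `sorry`)

Three stubs are named Literature facts (unproved in tree, theorems in print); the open stub is a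
weakening of an existing crux of another route. -/

/-- GZK is the tree fact bsd.S17 composed with the proved corank identity. [folklore] -/
theorem stub_gzkRange_of_fact
    (h : Literature.NumberTheory.EllipticCurves.rank_eq_analyticRank_of_analyticRank_le_one) :
    Statement.stub_gzkRange :=
  fun W _ p _ h1 =>
    Literature.NumberTheory.EllipticCurves.selmerCorank_eq_analyticRank_of_analyticRank_le_one
      h W p h1

/-- MOD is the tree fact `exists_isNewformOf` (modularity, level = conductor). [folklore] -/
theorem stub_modularity_of_fact
    (h : Literature.NumberTheory.EllipticCurves.ModularForms.exists_isNewformOf) :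
    Statement.stub_modularity :=
  fun W _ _ => h W

/-- KATO is the tree fact `kato_selmerCorank_le_order_padicLFunction` (Kato 2004 Thm 18.4, odd
good ordinary `p`) at `p ≥ 5`, through `isOrdinaryAt_iff`. [folklore] -/
theorem stub_katoCorankBound_of_fact
    (h : ∀ (W : WeierstrassCurve ℚ) [W.IsElliptic] [W.IsGloballyMinimal] (p : ℕ) [Fact p.Prime]
      {N : ℕ} [NeZero N] {f : CuspForm (CongruenceSubgroup.Gamma0 N) 2},
      Literature.NumberTheory.EllipticCurves.kato_selmerCorank_le_order_padicLFunction W p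
        (f := f)) :
    Statement.stub_katoCorankBound :=
  fun W _ _ p _ h5 hgood hord _ _ f hf => h W p (by omega) ⟨hgood, hord⟩ hf

/-- ORD is implied by (is the `≤`-half of, restricted to the sector and to `r_an ≥ 2`) crux
`PAdicOrderComparisonR2` of route PAdicOrderV2 (stmt-BirchSwinnertonDyer-0489). [folklore] -/
theorem stub_padicOrderLeAnalyticRank_of_comparison
    (h : Summit.BirchSwinnertonDyer.BirchSwinnertonDyer.Theses.PAdicOrderV2.PAdicOrderComparisonR2) :
    Statement.stub_padicOrderLeAnalyticRank :=
  fun W _ _ _ p _ _ hgood hord _ _ _ _ f hf => (h W p ⟨hgood, hord⟩ f hf).le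

end Summit.BirchSwinnertonDyer.BirchSwinnertonDyer.Cruxes.UBPotentiallyGood.Birth
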